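import Mathlib
import Summits.Ventures.HodgeRepro2.T5AdicCompletionHenselian
import Summits.Ventures.HodgeRepro2.T5AdicCompletionResidueField
import Summits.Ventures.HodgeRepro2.T5AdicCompletionNormSurjective

/-!
# Teichmüller lifts: every element of `k^×` lifts to a `(q − 1)`-th root of unity in `O_Kv`

Hensel's lemma at a finite place (`T5AdicCompletionHenselian`) applied to `X^{q−1} − 1`,
`q = |k| = N(v)` (`T5AdicCompletionResidueField.card_residueField`): the derivative
`(q − 1) z^{q−2}` is a unit at every `z ∈ k^×` because `q = 0` in `k`.  Hence the reduction map
from the `(q−1)`-th roots of unity of `O_Kv` to `k^×` is surjective (`exists_pow_card_sub_one_eq_one`,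
`exists_rootsOfUnity_residue_eq`); with `T5RootsOfUnityModMaximal` (row 89: a root of unity of order
prime to `p` congruent to `1` is `1`) it is the Teichmüller section `k^× ≅ μ_{q−1}(O_Kv)`, the
first factor of `O_Kv^× = μ_{q−1} × U^1` used by route/T5-route-2.md's (A3)(c) / (A10) bookkeeping.

Declaration per README §8(d): «uses an L-value-free non-vanishing device: NO».
-/

namespace Summit.Ventures.HodgeRepro2.T5TeichmullerLift

open IsDedekindDomain HeightOneSpectrum IsLocalRing Polynomial

variable {K : Type*} [Field K] [NumberField K] (v : HeightOneSpectrum (NumberField.RingOfIntegers K))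

/-- `q := |k| = N(v)` vanishes in the residue field. -/
theorem natCast_card_residueField_eq_zero :
    ((Nat.card (ResidueField (adicCompletionIntegers K v)) : ℕ) : ResidueField (adicCompletionIntegers K v)) = 0 := by
  haveI : Fintype (ResidueField (adicCompletionIntegers K v)) := Fintype.ofFinite _
  rw [Nat.card_eq_fintype_card]
  exact FiniteField.cast_card_eq_zero _

/-- `q − 1` is a unit of the residue field (it is `−1`). -/
theorem natCast_card_sub_one_ne_zero :
    ((Nat.card (ResidueField (adicCompletionIntegers K v)) - 1 : ℕ) : ResidueField (adicCompletionIntegers K v)) ≠ 0 := by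
  have h2 : 2 ≤ Nat.card (ResidueField (adicCompletionIntegers K v)) :=
    T5AdicCompletionNormSurjective.two_le_card_residueField v
  rw [Nat.cast_sub (by omega), natCast_card_residueField_eq_zero, Nat.cast_one, zero_sub, neg_ne_zero]
  exact one_ne_zero

/-- Every non-zero residue is a `(q − 1)`-th root of unity. -/
theorem residue_pow_card_sub_one {z : ResidueField (adicCompletionIntegers K v)} (h : z ≠ 0) :
    z ^ (Nat.card (ResidueField (adicCompletionIntegers K v)) - 1) = 1 := by
  haveI : Fintype (ResidueField (adicCompletionIntegers K v)) := Fintype.ofFinite _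
  rw [Nat.card_eq_fintype_card]
  exact FiniteField.pow_card_sub_one_eq_one z h

/-- THE TEICHMÜLLER LIFT: every `z ∈ k^×` is the residue of a `(q − 1)`-th root of unity `ζ ∈ O_Kv`
(Hensel for `X^{q−1} − 1`). -/
theorem exists_pow_card_sub_one_eq_one (z : ResidueField (adicCompletionIntegers K v)) (hζ : z ≠ 0) :
    ∃ ζ : adicCompletionIntegers K v,
      ζ ^ (Nat.card (ResidueField (adicCompletionIntegers K v)) - 1) = 1 ∧ residue _ ζ = z := by
  set q := Nat.card (ResidueField (adicCompletionIntegers K v)) with hq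
  have h2 : 2 ≤ q := T5AdicCompletionNormSurjective.two_le_card_residueField v
  obtain ⟨a₀, rfl⟩ := residue_surjective z
  have hmonic : (X ^ (q - 1) - C (1 : adicCompletionIntegers K v)).Monic :=
    monic_X_pow_sub_C _ (by omega)
  have h₁ : (X ^ (q - 1) - C (1 : adicCompletionIntegers K v)).eval a₀ ∈ maximalIdeal (adicCompletionIntegers K v) := by
    rw [← residue_eq_zero_iff, eval_sub, eval_pow, eval_X, eval_C, map_sub, map_pow, map_one,
      residue_pow_card_sub_one v hζ, sub_self]
  have h₂ : IsUnit ((X ^ (q - 1) - C (1 : adicCompletionIntegers K v)).derivative.eval a₀) := by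
    rw [← residue_ne_zero_iff_isUnit, derivative_sub, derivative_X_pow, derivative_C, sub_zero,
      eval_mul, eval_C, eval_pow, eval_X, map_mul, map_pow, map_natCast]
    refine mul_ne_zero (natCast_card_sub_one_ne_zero v) (pow_ne_zero _ hζ)
  obtain ⟨ζ, hroot, hζ₀⟩ := T5AdicCompletionHenselian.exists_isRoot_of_eval_mem_maximalIdeal v _ hmonic a₀ h₁ h₂
  refine ⟨ζ, ?_, ?_⟩
  · rw [IsRoot.def, eval_sub, eval_pow, eval_X, eval_C, sub_eq_zero] at hroot
    exact hroot
  · rw [← sub_eq_zero, ← map_sub, residue_eq_zero_iff]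
    exact hζ₀

/-- The reduction map `μ_{q−1}(O_Kv) → k^×` is surjective (the `rootsOfUnity` form). -/
theorem exists_rootsOfUnity_residue_eq (z : ResidueField (adicCompletionIntegers K v)) (hζ : z ≠ 0) :
    ∃ ζ : (adicCompletionIntegers K v)ˣ,
      ζ ∈ rootsOfUnity (Nat.card (ResidueField (adicCompletionIntegers K v)) - 1) (adicCompletionIntegers K v) ∧
        residue _ (ζ : adicCompletionIntegers K v) = z := by
  obtain ⟨ζ, hζ1, hζr⟩ := exists_pow_card_sub_one_eq_one v z hζ
  have hu : IsUnit ζ := by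
    rw [← residue_ne_zero_iff_isUnit, hζr]; exact hζ
  refine ⟨hu.unit, ?_, by simpa using hζr⟩
  rw [mem_rootsOfUnity]
  apply Units.ext
  simpa using hζ1

end Summit.Ventures.HodgeRepro2.T5TeichmullerLift
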